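import Summits.BirchSwinnertonDyer.BirchSwinnertonDyer.Theorems.PrintCFramBottomClassIndexLawFiveLeFlipRungOfJML
import HarnessLib

/-!
# Crux `PrintCFram.BottomClassIndexLawFiveLe` (stmt-BirchSwinnertonDyer-20372), line `eisenstein-resource-bdp-line` (registry v29,
# `stub_flipRungs.2` = (FlipRungTwo⁶)): T6 piece P5 — (RungTwo⁶) ON `4 ∥ m` ⟸ (JMLTwo⁶): THE 2-ADIC RUNG IN COHEN-NUMBER CURRENCY FROM
# THE 2-ADIC JOINT MODULAR LEMMA, and the `4 ∥ m` / `8 ∣ m` split of (RungTwo⁶)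
# (cell `bsd-print-cfram`, width seat `bsd-line-cfram-p1-w6` g10; THEOREMS ONLY, `--supports` 20372; BSD is not proved by any of this)

HONEST FRAMING. Nothing here is a statement about BSD; no registered stub is closed. Registry v29 (LEAD g14) carries
`stub_flipRungs := (FlipRungAll⁶) ∧ (FlipRungTwo⁶)`; w7 g8's layer A `flipRungTwo_six_of_rungTwo` (p711746) reduces (FlipRungTwo⁶) to
(RungTwo⁶) — «for a class datum `(p, m, χ, k)` with `2 ∣ m` and a `±1` pattern `τ` on the odd primes of `m`: `‖H(k, a)‖_p ≤ p⁻¹` at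
every index `a` of the `τ`-cut with `a/m ≡ 7 (mod 8)` ⟹ the same at every index of the `τ`-cut with `a/m ≡ 3 (mod 8)`». The modular
side of the 2-adic flipped-cusp rung (crux notes `Lines/eisenstein-resource-bdp-line-w7g8-T6.md` §2, §5b–5d: the cut form `G` of `H_k`
carrying the ODD conditions, `g = G|U_4`, Tunnell's class projections `P_c g` read at the cusp `W(∞)`, `W = γ₀·diag(64, 1)`, unit
weights on `n + c ≡ 2k+1 (mod 4)`, ¼-periodic junk, Katz's q-expansion principle) treats `4 ∥ m` (e = 2; `8 ∣ m` = piece P6 needs `U_2`,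
not in the tree). This file isolates what that modular side has to deliver as ONE statement with NO modular object in it —
**(JMLTwo⁶), the 2-adic joint modular lemma** (the `hJML` binder of `rungTwoFour_six_of_jmlTwo`): for a class datum with `4 ∥ m`, a pattern
`τ`, and the coefficient function `a = 𝟙_{AWAY₂}·H(k, ·)` of the odd-condition cut (`AWAY₂ i := m/4 ∣ i ∧ J(−(i/(m/4)) | q') = τ(q')` at the odd
primes `q' ∣ m` `∧ 3 ∤ i/(m/4)`), there is `N` (`p ∤ N`, `2 ∣ N`) such that for EVERY class `c (mod 8)`: if `a(4n) ∈ p·ℤ̄[1/N]` at every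
`n ≡ c (mod 8)` (i.e. `P_c g ≡ 0 (mod p)` at `∞`), then `a(4n) ∈ p·ℤ̄[1/N]` at every `n` with `n + c ≡ 2k+1 (mod 4)`, `4 ∤ n` (the live
frequencies of the odd part at the flipped cusp; w7 g8 P1/P1b/P1c, P3, P4). And it PROVES

* **`rungTwoFour_six_of_jmlTwo : (JMLTwo⁶) → (RungTwo⁶)∣_{¬ 8 ∣ m}`** — the TWO-STEP chain of the T6 notes §2: with `m = 4m₁`, the seed
  class `c_S = 7m₁ (mod 8)` is sent to `{n ≡ 2 (mod 4)}` (LIVENESS `c_S + 2 ≡ 2k+1 (mod 4)`, from `χ(−1)·(−1)^k = −1` and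
  `χ(−1)·m₁ ≡ 3 (mod 4)` — the even fundamental discriminant `χ(−1)·m = 4·(χ(−1)m₁)` has `χ(−1)m₁ ≡ 3 (mod 4)`), and the class `2` is sent
  to `{n odd, n + 2 ≡ 2k+1 (mod 4)} ∋ c_I = 3m₁ (mod 8)`; INPUT = the (RungTwo⁶) hypothesis on the full cut + Carlitz dyadicity + w8 g9's
  input reading; OUTPUT = w8 g9's output reading with the unit weight `1`. The intermediate class `{n ≡ 2 (mod 4)}` (indices with EVEN
  fundamental part) is never read `p`-adically: its membership is passed from conclusion to hypothesis inside the SAME `N`, which is why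
  (JMLTwo⁶) has ONE `N` for all classes `c`;
* **`rungTwo_six_of_four_of_eight : (RungTwo⁶)∣_{¬ 8 ∣ m} → (RungTwo⁶)∣_{8 ∣ m} → (RungTwo⁶)`** — the split LEAD's v30 can use to feed
  w7 g8's layer A with the `4 ∥ m` half closed by T6e and the `8 ∣ m` half (P6) left as the named residue.

* §1 `mod_eight_eq_of_odd_mul` (cancel an odd factor mod 8), `jacobiSym_neg_four_mul` (`J(−4r | q') = J(−r | q')` at odd primes),
  `four_dvd_and_sign_of_even_conductor` (`2 ∣ m`, `8 ∤ m` ⟹ `m = 4m₁`, `m₁` odd, `χ(−1)·m₁ ≡ 3 (mod 4)`), and for the modular side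
  `awayTwoResidue_add_iff` / **`exists_period_awayTwo_odd`** (AWAY₂ has the ODD period `3m₁²` — the vehicle `G` lives at level `4M′`, `M′` odd);
* §2 **`rungTwoFour_six_of_jmlTwo`**; §3 **`rungTwo_six_of_four_of_eight`** (the composition with w7 g8's layer A,
  `flipRungTwo_six_of_jmlTwo_of_eight : (JMLTwo⁶) → (RungTwo⁶)∣_{8 ∣ m} → (FlipRungTwo⁶)`, is the sequel file `…FlipRungTwoOfJMLGlue`).

No definitions, no named facts, no `sorry`. beyond-print theorem: NO (assembly / bookkeeping). References: crux notes w7g8-T6 §1d, §2, §5c–5d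
(STATUS 10:10:04Z UPSHOT: `|T| = 4` exactly on `n + c ≡ 2k+1 (mod 4)`); [Cohen1975] Thm. 3.1; [Katz1973] Cor. 1.6.2 (currency only);
[MontgomeryVaughan2007] Thm. 9.13 (fundamental discriminants).
-/

set_option autoImplicit false
-- summit-side namespace `Summit.BirchSwinnertonDyer.BirchSwinnertonDyer.…` (single-conjunct summit, D-0017 layout)
set_option linter.dupNamespace false

noncomputable section

open scoped Classical NumberTheorySymbols
open DirichletCharacter
open Literature.NumberTheory.ModularForms.CohenEisenstein

namespace Summit.BirchSwinnertonDyer.BirchSwinnertonDyer.Theorems.PrintCFram.FlipRung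

open Summit.BirchSwinnertonDyer.BirchSwinnertonDyer.Theorems.PrintCFram

/-! ## §1 Small pieces -/

/-- Cancelling an odd factor modulo `8`: `q·n ≡ q·r (mod 8)` with `q` odd gives `n ≡ r (mod 8)`. [folklore] -/
theorem mod_eight_eq_of_odd_mul {q n r : ℕ} (hq : q % 2 = 1) (h : q * n % 8 = q * r % 8) : n % 8 = r % 8 := by
  have h2 : Nat.Coprime 2 q := (Nat.Prime.coprime_iff_not_dvd Nat.prime_two).mpr (by omega)
  have h8 : Nat.Coprime 8 q := by
    rw [show (8 : ℕ) = 2 ^ 3 from rfl]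
    exact Nat.Coprime.pow_left 3 h2
  exact Nat.ModEq.cancel_left_of_coprime h8 h

/-- `J(−4r | q') = J(−r | q')` at an odd prime `q'` (`J(4 | q') = J(2 | q')² = 1`). [cite: IrelandRosen1990, Prop. 5.2.2] -/
theorem jacobiSym_neg_four_mul {q' : ℕ} (hq' : q'.Prime) (hq'2 : q' ≠ 2) (r : ℕ) :
    jacobiSym (-((4 * r : ℕ) : ℤ)) q' = jacobiSym (-(r : ℕ) : ℤ) q' := by
  have hcast : (-((4 * r : ℕ) : ℤ)) = (2 : ℤ) ^ 2 * (-((r : ℕ) : ℤ)) := by push_cast; ring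
  have hg : (2 : ℤ).gcd q' = 1 := by
    rw [show (2 : ℤ) = ((2 : ℕ) : ℤ) from rfl, Int.gcd_natCast_natCast]
    exact (Nat.coprime_primes Nat.prime_two hq').mpr (Ne.symm hq'2)
  rw [hcast, jacobiSym.mul_left, jacobiSym.sq_one' hg, one_mul]

/-- **An even conductor of a primitive quadratic character not divisible by `8` is `4m₁` with `m₁` odd and `χ(−1)·m₁ ≡ 3 (mod 4)`**
(`χ(−1)·m` is a fundamental discriminant; the even ones are `4d'` with `d' ≡ 2, 3 (mod 4)` squarefree, and `8 ∤ m` excludes `d' ≡ 2`).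
[cite: MontgomeryVaughan2007, Thm. 9.13] -/
theorem four_dvd_and_sign_of_even_conductor {p : ℕ} [Fact p.Prime] {m : ℕ} [NeZero m] {χ : DirichletCharacter ℚ_[p] m}
    (hχ : χ.IsPrimitive) (hχq : χ.IsQuadratic) {s : ℤ} (hs : χ (-1) = (s : ℚ_[p])) (hs1 : s = 1 ∨ s = -1)
    (h2 : 2 ∣ m) (h8 : ¬ 8 ∣ m) : 4 ∣ m ∧ m / 4 % 2 = 1 ∧ (s * ((m / 4 : ℕ) : ℤ)) % 4 = 3 := by
  rcases CohenCut.sign_mul_eq_one_or_isFundamental hχ hχq hs hs1 with h | ⟨h, -, -⟩ | ⟨h4, h23, -⟩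
  · exfalso; rcases hs1 with rfl | rfl <;> omega
  · exfalso; rcases hs1 with rfl | rfl <;> omega
  · have h4m : 4 ∣ m := by rcases hs1 with rfl | rfl <;> omega
    obtain ⟨m₁, rfl⟩ := h4m
    have hdiv : 4 * m₁ / 4 = m₁ := Nat.mul_div_cancel_left _ (by norm_num)
    rw [hdiv]
    refine ⟨dvd_mul_right _ _, ?_, ?_⟩
    · omega
    · rcases hs1 with rfl | rfl <;> push_cast at h23 ⊢ <;> omega

/-- The residue conditions of the odd-condition cut AWAY₂ on `ν = n/m_q` are invariant under `ν ↦ ν + D` whenever every odd prime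
`q' ∣ m` divides `D` and `3 ∣ D` (2-adic twin of w8 g9's `awayResidue_add_iff`: no `mod 4`/`mod 8` clause — those live in the class
projection). [folklore] -/
theorem awayTwoResidue_add_iff (m : ℕ) (τ : ℕ → ℤ) (ν D : ℕ)
    (hq' : ∀ q' : ℕ, q'.Prime → q' ∣ m → q' ≠ 2 → q' ∣ D) (h3 : 3 ∣ D) :
    ((∀ q' : ℕ, q'.Prime → q' ∣ m → q' ≠ 2 → jacobiSym (-(((ν + D : ℕ)) : ℤ)) q' = τ q') ∧ ¬ 3 ∣ ν + D) ↔
      ((∀ q' : ℕ, q'.Prime → q' ∣ m → q' ≠ 2 → jacobiSym (-((ν : ℕ) : ℤ)) q' = τ q') ∧ ¬ 3 ∣ ν) := by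
  have hJ : ∀ q' : ℕ, q'.Prime → q' ∣ m → q' ≠ 2 →
      jacobiSym (-(((ν + D : ℕ)) : ℤ)) q' = jacobiSym (-((ν : ℕ) : ℤ)) q' := by
    intro q' hqp hqm hq2
    obtain ⟨D', hD'⟩ := hq' q' hqp hqm hq2
    rw [jacobiSym.mod_left, jacobiSym.mod_left (-((ν : ℕ) : ℤ)) q']
    congr 1
    rw [hD']
    push_cast
    rw [show -((ν : ℤ) + (q' : ℤ) * D') = -(ν : ℤ) + (q' : ℤ) * (-(D' : ℤ)) by ring, Int.add_mul_emod_self_left]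
  rw [Nat.dvd_add_left h3]
  constructor
  · rintro ⟨h2, h6⟩
    exact ⟨fun q' hqp hqm hq2 ↦ (hJ q' hqp hqm hq2) ▸ h2 q' hqp hqm hq2, h6⟩
  · rintro ⟨h2, h6⟩
    exact ⟨fun q' hqp hqm hq2 ↦ (hJ q' hqp hqm hq2).symm ▸ h2 q' hqp hqm hq2, h6⟩

/-- **An ODD period of the odd-condition cut AWAY₂** (the shape the vehicle `G` of the 2-adic rung consumes: `G` = the AWAY₂-cut of
`H_k`, a form of level `4M′` with `M′` odd): if `m_q` is odd and every odd prime of `m` divides `m_q` (e.g. `m = 4m_q`), the predicate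
`m_q ∣ n ∧ (J(−(n/m_q) | q') = τ(q')` at the odd primes `q' ∣ m`) `∧ 3 ∤ n/m_q` is periodic with the odd period `Q₀ = 3m_q²`, `m_q ∣ Q₀`.
[folklore] -/
theorem exists_period_awayTwo_odd (m mq : ℕ) (τ : ℕ → ℤ) (hmq : 0 < mq) (hmq2 : mq % 2 = 1)
    (hprimes : ∀ q' : ℕ, q'.Prime → q' ∣ m → q' ≠ 2 → q' ∣ mq) :
    ∃ Q₀ : ℕ, 0 < Q₀ ∧ Q₀ % 2 = 1 ∧ mq ∣ Q₀ ∧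
      Function.Periodic (fun n : ℕ =>
        mq ∣ n ∧ (∀ q' : ℕ, q'.Prime → q' ∣ m → q' ≠ 2 → jacobiSym (-((n / mq : ℕ) : ℤ)) q' = τ q') ∧
          ¬ 3 ∣ n / mq) Q₀ := by
  refine ⟨mq * (3 * mq), by positivity, ?_, dvd_mul_right _ _, fun n => ?_⟩
  · have h : mq * (3 * mq) % 2 = (mq % 2) * ((3 * mq) % 2) % 2 := Nat.mul_mod _ _ _
    have h3 : 3 * mq % 2 = 1 := by omega
    rw [h, hmq2, h3]
  · simp only
    have hdiv : (n + mq * (3 * mq)) / mq = n / mq + 3 * mq := Nat.add_mul_div_left _ _ hmq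
    have hdvd : mq ∣ n + mq * (3 * mq) ↔ mq ∣ n := Nat.dvd_add_left (dvd_mul_right mq _)
    rw [hdiv, hdvd, awayTwoResidue_add_iff m τ (n / mq) (3 * mq)
      (fun q' hq hqm hq2 => (hprimes q' hq hqm hq2).mul_left 3) (dvd_mul_right 3 mq)]

/-! ## §2 (RungTwo⁶) on `4 ∥ m` ⟸ (JMLTwo⁶) -/

/-- **THE 2-ADIC RUNG IN COHEN-NUMBER CURRENCY (on `4 ∥ m`) FROM THE 2-ADIC JOINT MODULAR LEMMA.** See the module docstring for
(JMLTwo⁶) (the hypothesis `hJML`: datum binders of (RungTwo⁶) followed by `4 ∣ m`, `¬ 8 ∣ m`; the pattern `τ`; the odd-condition cut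
coefficient function `a`; ONE `N` for every class `c`; hypothesis «`a(4n) ∈ p·ℤ̄[1/N]` on `n ≡ c (mod 8)`», conclusion «the same on
`n + c ≡ 2k+1 (mod 4)`, `4 ∤ n`») and for the conclusion ((RungTwo⁶) = `hRung` of `flipRungTwo_six_of_rungTwo` with `¬ 8 ∣ m` inserted
after `2 ∣ m`). PROOF. `m = 4m₁`, `m₁` odd, `χ(−1)m₁ ≡ 3 (mod 4)` (`four_dvd_and_sign_of_even_conductor`); with `χ(−1)(−1)^k = −1`:
`k` odd ∧ `m₁ ≡ 3 (4)` or `k` even ∧ `m₁ ≡ 1 (4)`, so `n + 7m₁ ≡ 2k+1 (mod 4)` for every `n ≡ 2 (mod 4)` (LIVENESS) and `3m₁r' + 2 ≡ 2k+1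
(mod 4)` for `r' ≡ 3 (mod 8)` (TARGET). INPUT at `c_S = 7m₁`: an index `4n`, `n ≡ 7m₁ (8)`, in AWAY₂ has `n = m₁r`, `r ≡ 7 (8)`, same
pattern (`J(−4r|q') = J(−r|q')`), `3 ∤ r` — a FULL index of class `7`, so `‖H(k, 4n)‖_p ≤ p⁻¹` (hypothesis), `2^j·H ∈ ℤ` (Carlitz), hence
`a(4n) ∈ p·ℤ̄[1/N]` (input reading); off AWAY₂ `a = 0`. STEP 1 (class `7m₁`) gives membership on `{n ≡ 2 (mod 4)} ⊇ {n ≡ 2 (mod 8)}`;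
STEP 2 (class `2`) gives it on `{n + 2 ≡ 2k+1 (mod 4), 4 ∤ n}`, which contains `n' = m₁r'` for the target FULL index `a' = m r' = 4n'`,
`r' ≡ 3 (mod 8)`; there `a(4n') = H(k, a')` and the output reading (weight `1`) gives `‖H(k, a')‖_p ≤ p⁻¹`.
[cite: Cohen1975, Thm. 3.1] [cite: Katz1973, §1.6 Cor. 1.6.2] -/
theorem rungTwoFour_six_of_jmlTwo
    (hJML : ∀ (p : ℕ) [Fact p.Prime] (m : ℕ) [NeZero m] (χ : DirichletCharacter ℚ_[p] m) (k : ℕ),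
      (p = 7 ∨ p = 11 ∨ p = 19 ∨ p = 43 ∨ p = 67 ∨ p = 163) →
      m.Coprime p → χ.IsPrimitive → χ.IsQuadratic → (k = (p + 1) / 4 ∨ k = (3 * p - 1) / 4) →
      2 ≤ k → k ≤ p - 2 → χ (-1) * (-1) ^ k = -1 → 2 ∣ m → 4 ∣ m → ¬ 8 ∣ m →
      ∀ (τ : ℕ → ℤ), (∀ q' : ℕ, q'.Prime → q' ∣ m → q' ≠ 2 → (τ q' = 1 ∨ τ q' = -1)) →
      ∀ (a : ℕ → ℚ),
        (∀ i : ℕ, (m / 4 ∣ i ∧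
            (∀ q' : ℕ, q'.Prime → q' ∣ m → q' ≠ 2 → jacobiSym (-((i / (m / 4) : ℕ) : ℤ)) q' = τ q') ∧
            ¬ 3 ∣ i / (m / 4)) → a i = cohenH k i) →
        (∀ i : ℕ, ¬ (m / 4 ∣ i ∧
            (∀ q' : ℕ, q'.Prime → q' ∣ m → q' ≠ 2 → jacobiSym (-((i / (m / 4) : ℕ) : ℤ)) q' = τ q') ∧
            ¬ 3 ∣ i / (m / 4)) → a i = 0) →
      ∃ N : ℕ, ¬ p ∣ N ∧ 2 ∣ N ∧
        ∀ c : ℕ,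
          (∀ n : ℕ, n % 8 = c % 8 →
            ∃ y : ℂ, (∃ j : ℕ, IsIntegral ℤ ((N : ℂ) ^ j * y)) ∧ ((a (4 * n) : ℚ) : ℂ) = (p : ℂ) * y) →
          ∀ n : ℕ, (n + c) % 4 = (2 * k + 1) % 4 → ¬ 4 ∣ n →
            ∃ y : ℂ, (∃ j : ℕ, IsIntegral ℤ ((N : ℂ) ^ j * y)) ∧ ((a (4 * n) : ℚ) : ℂ) = (p : ℂ) * y) :
    ∀ (p : ℕ) [Fact p.Prime] (m : ℕ) [NeZero m] (χ : DirichletCharacter ℚ_[p] m) (k : ℕ),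
      (p = 7 ∨ p = 11 ∨ p = 19 ∨ p = 43 ∨ p = 67 ∨ p = 163) →
      m.Coprime p → χ.IsPrimitive → χ.IsQuadratic → (k = (p + 1) / 4 ∨ k = (3 * p - 1) / 4) →
      2 ≤ k → k ≤ p - 2 → χ (-1) * (-1) ^ k = -1 → 2 ∣ m → ¬ 8 ∣ m →
      ∀ (τ : ℕ → ℤ), (∀ q' : ℕ, q'.Prime → q' ∣ m → q' ≠ 2 → (τ q' = 1 ∨ τ q' = -1)) →
      (∀ a : ℕ, m ∣ a → a / m % 4 = 3 →
        (∀ q' : ℕ, q'.Prime → q' ∣ m → q' ≠ 2 → jacobiSym (-((a / m : ℕ) : ℤ)) q' = τ q') →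
        a / m % 8 = 7 → ¬ 3 ∣ a / m → ‖((cohenH k a : ℚ) : ℚ_[p])‖ ≤ (p : ℝ)⁻¹) →
      ∀ a : ℕ, m ∣ a → a / m % 4 = 3 →
        (∀ q' : ℕ, q'.Prime → q' ∣ m → q' ≠ 2 → jacobiSym (-((a / m : ℕ) : ℤ)) q' = τ q') →
        a / m % 8 = 3 → ¬ 3 ∣ a / m → ‖((cohenH k a : ℚ) : ℚ_[p])‖ ≤ (p : ℝ)⁻¹ := by
  intro p _ m _ χ k hp6 hmp hχ hχq hk hk2 hkp hpar h2m h8m τ hτ hcut a' hma' ha4' hJ' h83' h3'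
  have hm0 : 0 < m := Nat.pos_of_ne_zero (NeZero.ne m)
  have hk1 : 1 ≤ k := by omega
  -- the sign `s = χ(−1)`, `m = 4m₁`, `m₁` odd, `s·m₁ ≡ 3 (mod 4)`
  obtain ⟨s, hs1', hs⟩ := Literature.NumberTheory.LFunctions.PrimitiveQuadratic.exists_sign_eq_of_charZero χ
  have hs1 : s = 1 ∨ s = -1 := by rcases hs1' with ⟨h, -⟩ | ⟨h, -⟩ <;> simp [h]
  obtain ⟨h4m, hm₁odd, hsm₁⟩ := four_dvd_and_sign_of_even_conductor hχ hχq hs hs1 h2m h8m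
  obtain ⟨m₁, hm⟩ := h4m
  have hmq : m / 4 = m₁ := by rw [hm, Nat.mul_div_cancel_left _ (by norm_num)]
  rw [hmq] at hm₁odd hsm₁
  have hm₁0 : 0 < m₁ := by omega
  have hm1 : m ≠ 1 := by omega
  -- parity bookkeeping: `s·(−1)^k = −1` ⟹ (`k` odd ∧ `m₁ ≡ 3 (4)`) ∨ (`k` even ∧ `m₁ ≡ 1 (4)`)
  have hkm : (k % 2 = 1 ∧ m₁ % 4 = 3) ∨ (k % 2 = 0 ∧ m₁ % 4 = 1) := by
    rw [hs] at hpar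
    rcases hs1 with rfl | rfl
    · left
      refine ⟨?_, by omega⟩
      rcases Nat.even_or_odd k with hk' | hk'
      · exfalso
        rw [hk'.neg_one_pow] at hpar
        norm_num at hpar
      · exact Nat.odd_iff.mp hk'
    · right
      refine ⟨?_, by omega⟩
      rcases Nat.even_or_odd k with hk' | hk'
      · exact Nat.even_iff.mp hk'
      · exfalso
        rw [hk'.neg_one_pow] at hpar
        norm_num at hpar
  -- the coefficient function of the odd-condition cut
  set a : ℕ → ℚ := fun i =>
    if (m / 4 ∣ i ∧
        (∀ q' : ℕ, q'.Prime → q' ∣ m → q' ≠ 2 → jacobiSym (-((i / (m / 4) : ℕ) : ℤ)) q' = τ q') ∧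
        ¬ 3 ∣ i / (m / 4))
    then cohenH k i else 0 with hadef
  obtain ⟨N, hpN, h2N, hstep⟩ :=
    hJML p m χ k hp6 hmp hχ hχq hk hk2 hkp hpar h2m ⟨m₁, hm⟩ h8m τ hτ a
      (fun i hi => by rw [hadef]; exact if_pos hi) (fun i hi => by rw [hadef]; exact if_neg hi)
  -- `m₁ ∣ 4n ⟹ m₁ ∣ n`
  have hcop4 : Nat.Coprime m₁ 4 := by
    rw [show (4 : ℕ) = 2 ^ 2 from rfl]
    exact Nat.Coprime.pow_right 2 (Nat.coprime_comm.mp ((Nat.Prime.coprime_iff_not_dvd Nat.prime_two).mpr (by omega)))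
  -- INPUT: class `c_S = 7m₁`
  have hin : ∀ n : ℕ, n % 8 = 7 * m₁ % 8 →
      ∃ y : ℂ, (∃ j : ℕ, IsIntegral ℤ ((N : ℂ) ^ j * y)) ∧ ((a (4 * n) : ℚ) : ℂ) = (p : ℂ) * y := by
    intro n hn8
    by_cases hA : (m / 4 ∣ 4 * n ∧
        (∀ q' : ℕ, q'.Prime → q' ∣ m → q' ≠ 2 → jacobiSym (-((4 * n / (m / 4) : ℕ) : ℤ)) q' = τ q') ∧
        ¬ 3 ∣ 4 * n / (m / 4))
    · have ha : a (4 * n) = cohenH k (4 * n) := by rw [hadef]; exact if_pos hA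
      obtain ⟨hm₁n, hJn, h3n⟩ := hA
      rw [hmq] at hm₁n hJn h3n
      have hm₁n' : m₁ ∣ n := hcop4.dvd_of_dvd_mul_left hm₁n
      obtain ⟨r, rfl⟩ := hm₁n'
      have hdiv₁ : 4 * (m₁ * r) / m₁ = 4 * r := by
        rw [show 4 * (m₁ * r) = m₁ * (4 * r) by ring, Nat.mul_div_cancel_left _ hm₁0]
      rw [hdiv₁] at hJn h3n
      have hma : m ∣ 4 * (m₁ * r) := ⟨r, by rw [hm]; ring⟩
      have hdivm : 4 * (m₁ * r) / m = r := by
        rw [hm, show 4 * (m₁ * r) = (4 * m₁) * r by ring, Nat.mul_div_cancel_left _ (by omega)]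
      have hr8 : r % 8 = 7 := by
        have h := mod_eight_eq_of_odd_mul hm₁odd (n := r) (r := 7) (by rw [hn8, mul_comm])
        simpa using h
      have hr4 : r % 4 = 3 := by omega
      have hJ : ∀ q' : ℕ, q'.Prime → q' ∣ m → q' ≠ 2 → jacobiSym (-((4 * (m₁ * r) / m : ℕ) : ℤ)) q' = τ q' := by
        intro q' hq' hq'm hq'2
        rw [hdivm, ← jacobiSym_neg_four_mul hq' hq'2 r]
        exact hJn q' hq' hq'm hq'2
      have h3 : ¬ 3 ∣ 4 * (m₁ * r) / m := by
        rw [hdivm]; exact fun h => h3n (dvd_mul_of_dvd_right h 4)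
      have hnorm := hcut (4 * (m₁ * r)) hma (by rw [hdivm]; exact hr4) hJ (by rw [hdivm]; exact hr8) h3
      have h2 := exists_two_pow_mul_cohenH_eq_intCast_of_cut_sign hm1 hχ hχq hk1 hpar hτ hma
        (by rw [hdivm]; exact hr4) hJ
      rw [ha]
      exact exists_eq_prime_mul_isIntegral_of_padicNorm_le h2N hnorm h2
    · have ha : a (4 * n) = 0 := by rw [hadef]; exact if_neg hA
      rw [ha]
      exact ⟨0, ⟨0, by simpa using isIntegral_zero⟩, by simp⟩
  -- STEP 1: class `7m₁` ↦ `{n + 7m₁ ≡ 2k+1 (mod 4), 4 ∤ n} ⊇ {n ≡ 2 (mod 4)}` (LIVENESS)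
  have hmid := hstep (7 * m₁) hin
  have hin2 : ∀ n : ℕ, n % 8 = 2 % 8 →
      ∃ y : ℂ, (∃ j : ℕ, IsIntegral ℤ ((N : ℂ) ^ j * y)) ∧ ((a (4 * n) : ℚ) : ℂ) = (p : ℂ) * y := by
    intro n hn8
    refine hmid n ?_ (by omega)
    rcases hkm with ⟨hk', hm₁'⟩ | ⟨hk', hm₁'⟩ <;> omega
  -- STEP 2: class `2` ↦ `{n + 2 ≡ 2k+1 (mod 4), 4 ∤ n}`
  have hout := hstep 2 hin2
  -- the target index `a' = m r' = 4·(m₁ r')`, `r' ≡ 3 (mod 8)`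
  obtain ⟨r', rfl⟩ := hma'
  have hdiv' : m * r' / m = r' := Nat.mul_div_cancel_left _ hm0
  rw [hdiv'] at ha4' hJ' h83' h3'
  have ha'eq : m * r' = 4 * (m₁ * r') := by rw [hm]; ring
  have hdiv₁' : 4 * (m₁ * r') / m₁ = 4 * r' := by
    rw [show 4 * (m₁ * r') = m₁ * (4 * r') by ring, Nat.mul_div_cancel_left _ hm₁0]
  have hA' : (m / 4 ∣ 4 * (m₁ * r') ∧
      (∀ q' : ℕ, q'.Prime → q' ∣ m → q' ≠ 2 → jacobiSym (-((4 * (m₁ * r') / (m / 4) : ℕ) : ℤ)) q' = τ q') ∧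
      ¬ 3 ∣ 4 * (m₁ * r') / (m / 4)) := by
    rw [hmq, hdiv₁']
    refine ⟨⟨4 * r', by ring⟩, fun q' hq' hq'm hq'2 => ?_, fun h => h3' ?_⟩
    · rw [jacobiSym_neg_four_mul hq' hq'2 r']
      exact hJ' q' hq' hq'm hq'2
    · exact (Nat.Coprime.dvd_of_dvd_mul_left (by norm_num : Nat.Coprime 3 4) h)
  have ha : a (4 * (m₁ * r')) = cohenH k (4 * (m₁ * r')) := by rw [hadef]; exact if_pos hA'
  have htgt : (m₁ * r' + 2) % 4 = (2 * k + 1) % 4 := by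
    have hmul : m₁ * r' % 4 = (m₁ % 4) * (r' % 4) % 4 := Nat.mul_mod _ _ _
    have hr'4 : r' % 4 = 3 := by omega
    rcases hkm with ⟨hk', hm₁'⟩ | ⟨hk', hm₁'⟩ <;> rw [hm₁', hr'4] at hmul <;> omega
  have hnot4 : ¬ 4 ∣ m₁ * r' := by
    have hmul : m₁ * r' % 2 = (m₁ % 2) * (r' % 2) % 2 := Nat.mul_mod _ _ _
    have hr'2 : r' % 2 = 1 := by omega
    rw [hm₁odd, hr'2] at hmul
    omega
  obtain ⟨y, hy, hxy⟩ := hout (m₁ * r') htgt hnot4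
  rw [ha] at hxy
  rw [ha'eq]
  exact padicNorm_le_inv_of_mul_unit_eq_prime_mul hpN (w := 1) one_ne_zero (by simp) hy
    (by rw [mul_one]; exact hxy)

/-! ## §3 The `4 ∥ m` / `8 ∣ m` split of (RungTwo⁶) -/

/-- **(RungTwo⁶) FROM ITS `4 ∥ m` HALF AND ITS `8 ∣ m` HALF** (case split on `8 ∣ m`; both halves are (RungTwo⁶)'s text with the extra
binder inserted after `2 ∣ m`). The `4 ∥ m` half is `rungTwoFour_six_of_jmlTwo` ∘ T6e; the `8 ∣ m` half (piece P6: `g = G|U_8`, one-step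
rung (ii) of the T6 notes §2, needs `U_2` on half-integral weight forms — not in the tree) is the named residue. Conclusion = the `hRung`
binder of w7 g8's layer A `flipRungTwo_six_of_rungTwo` VERBATIM. [cite: Cohen1975, Thm. 3.1] -/
theorem rungTwo_six_of_four_of_eight
    (hFour : ∀ (p : ℕ) [Fact p.Prime] (m : ℕ) [NeZero m] (χ : DirichletCharacter ℚ_[p] m) (k : ℕ),
      (p = 7 ∨ p = 11 ∨ p = 19 ∨ p = 43 ∨ p = 67 ∨ p = 163) →
      m.Coprime p → χ.IsPrimitive → χ.IsQuadratic → (k = (p + 1) / 4 ∨ k = (3 * p - 1) / 4) →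
      2 ≤ k → k ≤ p - 2 → χ (-1) * (-1) ^ k = -1 → 2 ∣ m → ¬ 8 ∣ m →
      ∀ (τ : ℕ → ℤ), (∀ q' : ℕ, q'.Prime → q' ∣ m → q' ≠ 2 → (τ q' = 1 ∨ τ q' = -1)) →
      (∀ a : ℕ, m ∣ a → a / m % 4 = 3 →
        (∀ q' : ℕ, q'.Prime → q' ∣ m → q' ≠ 2 → jacobiSym (-((a / m : ℕ) : ℤ)) q' = τ q') →
        a / m % 8 = 7 → ¬ 3 ∣ a / m → ‖((cohenH k a : ℚ) : ℚ_[p])‖ ≤ (p : ℝ)⁻¹) →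
      ∀ a : ℕ, m ∣ a → a / m % 4 = 3 →
        (∀ q' : ℕ, q'.Prime → q' ∣ m → q' ≠ 2 → jacobiSym (-((a / m : ℕ) : ℤ)) q' = τ q') →
        a / m % 8 = 3 → ¬ 3 ∣ a / m → ‖((cohenH k a : ℚ) : ℚ_[p])‖ ≤ (p : ℝ)⁻¹)
    (hEight : ∀ (p : ℕ) [Fact p.Prime] (m : ℕ) [NeZero m] (χ : DirichletCharacter ℚ_[p] m) (k : ℕ),
      (p = 7 ∨ p = 11 ∨ p = 19 ∨ p = 43 ∨ p = 67 ∨ p = 163) →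
      m.Coprime p → χ.IsPrimitive → χ.IsQuadratic → (k = (p + 1) / 4 ∨ k = (3 * p - 1) / 4) →
      2 ≤ k → k ≤ p - 2 → χ (-1) * (-1) ^ k = -1 → 2 ∣ m → 8 ∣ m →
      ∀ (τ : ℕ → ℤ), (∀ q' : ℕ, q'.Prime → q' ∣ m → q' ≠ 2 → (τ q' = 1 ∨ τ q' = -1)) →
      (∀ a : ℕ, m ∣ a → a / m % 4 = 3 →
        (∀ q' : ℕ, q'.Prime → q' ∣ m → q' ≠ 2 → jacobiSym (-((a / m : ℕ) : ℤ)) q' = τ q') →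
        a / m % 8 = 7 → ¬ 3 ∣ a / m → ‖((cohenH k a : ℚ) : ℚ_[p])‖ ≤ (p : ℝ)⁻¹) →
      ∀ a : ℕ, m ∣ a → a / m % 4 = 3 →
        (∀ q' : ℕ, q'.Prime → q' ∣ m → q' ≠ 2 → jacobiSym (-((a / m : ℕ) : ℤ)) q' = τ q') →
        a / m % 8 = 3 → ¬ 3 ∣ a / m → ‖((cohenH k a : ℚ) : ℚ_[p])‖ ≤ (p : ℝ)⁻¹) :
    ∀ (p : ℕ) [Fact p.Prime] (m : ℕ) [NeZero m] (χ : DirichletCharacter ℚ_[p] m) (k : ℕ),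
      (p = 7 ∨ p = 11 ∨ p = 19 ∨ p = 43 ∨ p = 67 ∨ p = 163) →
      m.Coprime p → χ.IsPrimitive → χ.IsQuadratic → (k = (p + 1) / 4 ∨ k = (3 * p - 1) / 4) →
      2 ≤ k → k ≤ p - 2 → χ (-1) * (-1) ^ k = -1 → 2 ∣ m →
      ∀ (τ : ℕ → ℤ), (∀ q' : ℕ, q'.Prime → q' ∣ m → q' ≠ 2 → (τ q' = 1 ∨ τ q' = -1)) →
      (∀ a : ℕ, m ∣ a → a / m % 4 = 3 →
        (∀ q' : ℕ, q'.Prime → q' ∣ m → q' ≠ 2 → jacobiSym (-((a / m : ℕ) : ℤ)) q' = τ q') →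
        a / m % 8 = 7 → ¬ 3 ∣ a / m → ‖((cohenH k a : ℚ) : ℚ_[p])‖ ≤ (p : ℝ)⁻¹) →
      ∀ a : ℕ, m ∣ a → a / m % 4 = 3 →
        (∀ q' : ℕ, q'.Prime → q' ∣ m → q' ≠ 2 → jacobiSym (-((a / m : ℕ) : ℤ)) q' = τ q') →
        a / m % 8 = 3 → ¬ 3 ∣ a / m → ‖((cohenH k a : ℚ) : ℚ_[p])‖ ≤ (p : ℝ)⁻¹ := by
  intro p _ m _ χ k hp6 hmp hχ hχq hk hk2 hkp hpar h2m τ hτ hcut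
  by_cases h8 : 8 ∣ m
  · exact hEight p m χ k hp6 hmp hχ hχq hk hk2 hkp hpar h2m h8 τ hτ hcut
  · exact hFour p m χ k hp6 hmp hχ hχq hk hk2 hkp hpar h2m h8 τ hτ hcut

end Summit.BirchSwinnertonDyer.BirchSwinnertonDyer.Theorems.PrintCFram.FlipRung

end
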